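import Mathlib
import Literature.Probability.PointProcesses.LensConsistentLaw
import Literature.MathematicalPhysics.StatisticalMechanics.PeriodicConfigurationDelone
import HarnessLib

/-!
# Crux `PatternPricedCertificates` (stmt-AtomisticToContinuum-12974), line `registered` — stub `stub_periodicMeanFamily`

This file discharges the registered tool stub `stub_periodicMeanFamily` (T1) of line `registered`
for crux stmt-AtomisticToContinuum-12974
(`Summit.AtomisticToContinuum.Crystallization.Theses.FrustrationRangeCertificates.PatternPricedCertificates`).

**Statement.** Let `Q` be a periodic configuration of `ℝ³` whose point set is `δ`-separated. For a
radius `ρ` and a motif point `x`, the rooted `ρ`-pattern of `Q` at `x` is the finite set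
`PAT ρ x = {y − x | y ∈ Q.points, y ≠ x, dist y x ≤ ρ}` (spelled with
`PeriodicConfiguration.finite_inter_points` of the closed `ρ`-ball about `x`), and the periodic mean
is `ℓ ρ f = (#motif)⁻¹ Σ_{x ∈ motif} f (PAT ρ x)`. Then `ℓ ρ` is additive, homogeneous,
nonnegative on functionals valued in `[0, 1]` on `(δ, ρ)`-admissible rooted patterns, normalised
(`ℓ ρ 1 = 1`), and the family is projective: `ℓ ρ' (f ∘ B_ρ) = ℓ ρ f` for `ρ ≤ ρ'`
(`B_ρ = ballPattern ρ`). (Lens-consistency — transports vanish on average — is the separate stub T2.)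

**Proof (folklore).**
* `periodicMeanFamily_mem_pattern`: membership in `PAT ρ x`;
* `periodicMeanFamily_isRootedPattern`: for `x ∈ Q.points` the pattern `PAT ρ x` is
  `(δ, ρ)`-admissible (norms `‖y − x‖ = dist y x ∈ [δ, ρ]` by separation; differences
  `‖(y − x) − (y' − x)‖ = dist y y' ≥ δ`);
* `periodicMeanFamily_ballPattern_pattern`: `B_ρ (PAT ρ' x) = PAT ρ x` for `ρ ≤ ρ'`;
* the five clauses are then finite-sum algebra over the (non-empty) motif
  (`Finset.sum_add_distrib`, `Finset.mul_sum`, `Finset.sum_nonneg`, `Finset.sum_const`).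

No new definitions; nothing is assumed. [folklore]
-/

noncomputable section

open scoped BigOperators Classical

namespace Summit.AtomisticToContinuum.Crystallization.Theorems.PatternPricedCertificates

open Literature.Probability.PointProcesses (IsRootedPattern ballPattern)
open Literature.MathematicalPhysics.StatisticalMechanics (PeriodicConfiguration)

section Helpers

variable {d : ℕ} (Q : PeriodicConfiguration d)

/-- Membership in the rooted `ρ`-pattern of a periodic configuration at `x`: `v` belongs to it iff
`v = y − x` for a point `y ≠ x` of the configuration with `dist y x ≤ ρ`. [folklore] -/
theorem periodicMeanFamily_mem_pattern (ρ : ℝ) (x v : EuclideanSpace ℝ (Fin d)) :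
    v ∈ ((Q.finite_inter_points (Metric.isBounded_closedBall (x := x) (r := ρ))).toFinset.erase x).image
        (fun y => y - x) ↔
      ∃ y ∈ Q.points, y ≠ x ∧ dist y x ≤ ρ ∧ y - x = v := by
  simp only [Finset.mem_image, Finset.mem_erase, Set.Finite.mem_toFinset, Set.mem_inter_iff,
    Metric.mem_closedBall]
  constructor
  · rintro ⟨y, ⟨hyx, hyρ, hy⟩, rfl⟩
    exact ⟨y, hy, hyx, hyρ, rfl⟩
  · rintro ⟨y, hy, hyx, hyρ, rfl⟩
    exact ⟨y, ⟨hyx, hyρ, hy⟩, rfl⟩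

/-- The rooted `ρ`-pattern at a point `x` of a `δ`-separated periodic configuration is a
`(δ, ρ)`-admissible rooted pattern: its elements `y − x` have norm `dist y x ∈ [δ, ρ]`, and two of
them differ by `y − y'`, of norm `dist y y' ≥ δ`. [folklore] -/
theorem periodicMeanFamily_isRootedPattern {δ : ℝ}
    (hsep : ∀ x ∈ Q.points, ∀ y ∈ Q.points, x ≠ y → δ ≤ dist x y) (ρ : ℝ)
    {x : EuclideanSpace ℝ (Fin d)} (hx : x ∈ Q.points) :
    IsRootedPattern δ ρ
      (((Q.finite_inter_points (Metric.isBounded_closedBall (x := x) (r := ρ))).toFinset.erase x).image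
        (fun y => y - x)) := by
  refine ⟨fun v hv => ?_, fun v hv w hw hvw => ?_⟩
  · obtain ⟨y, hy, hyx, hyρ, rfl⟩ := (periodicMeanFamily_mem_pattern Q ρ x v).1 hv
    rw [← dist_eq_norm]
    exact ⟨hsep y hy x hx hyx, hyρ⟩
  · obtain ⟨y, hy, -, -, rfl⟩ := (periodicMeanFamily_mem_pattern Q ρ x v).1 hv
    obtain ⟨y', hy', -, -, rfl⟩ := (periodicMeanFamily_mem_pattern Q ρ x w).1 hw
    have hyy' : y ≠ y' := fun h => hvw (by rw [h])
    rw [sub_sub_sub_cancel_right, ← dist_eq_norm]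
    exact hsep y hy y' hy' hyy'

/-- Projectivity of rooted patterns: for `ρ ≤ ρ'`, cutting the `ρ'`-pattern at `x` to the closed
`ρ`-ball gives the `ρ`-pattern at `x`. [folklore] -/
theorem periodicMeanFamily_ballPattern_pattern {ρ ρ' : ℝ} (h : ρ ≤ ρ')
    (x : EuclideanSpace ℝ (Fin d)) :
    ballPattern ρ
        (((Q.finite_inter_points (Metric.isBounded_closedBall (x := x) (r := ρ'))).toFinset.erase x).image
          (fun y => y - x)) =
      ((Q.finite_inter_points (Metric.isBounded_closedBall (x := x) (r := ρ))).toFinset.erase x).image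
        (fun y => y - x) := by
  ext v
  simp only [ballPattern, Finset.mem_filter, periodicMeanFamily_mem_pattern]
  constructor
  · rintro ⟨⟨y, hy, hyx, -, rfl⟩, hv⟩
    rw [← dist_eq_norm] at hv
    exact ⟨y, hy, hyx, hv, rfl⟩
  · rintro ⟨y, hy, hyx, hyρ, rfl⟩
    refine ⟨⟨y, hy, hyx, hyρ.trans h, rfl⟩, ?_⟩
    rw [← dist_eq_norm]
    exact hyρ

end Helpers

/-- **Stub `stub_periodicMeanFamily` (T1: periodic configurations rooted uniformly over the motif
are mean families).** For a periodic configuration `Q` of `ℝ³` whose point set is `δ`-separated,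
the functional `ℓ_Q ρ f := (#motif)⁻¹ Σ_{x ∈ motif} f (PAT ρ x)`, `PAT ρ x` the rooted `ρ`-pattern
`{y − x | y ∈ Q.points, y ≠ x, dist y x ≤ ρ}`, is additive, homogeneous, nonnegative on
`[0, 1]`-valued functionals on `(δ, ρ)`-admissible patterns (`periodicMeanFamily_isRootedPattern`),
normalised (the motif is non-empty), and projective (`periodicMeanFamily_ballPattern_pattern`:
`B_ρ` of the `ρ'`-pattern is the `ρ`-pattern). [folklore] -/
theorem stub_periodicMeanFamily :
    ∀ (δ : ℝ) (Q : Literature.MathematicalPhysics.StatisticalMechanics.PeriodicConfiguration 3), 0 < δ → (∀ x ∈ Q.points, ∀ y ∈ Q.points, x ≠ y → δ ≤ dist x y) →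
      (∀ (ρ : ℝ) (f₁ f₂ : Finset (EuclideanSpace ℝ (Fin 3)) → ℝ),
        ((Q.motif.card : ℝ)⁻¹ * ∑ x ∈ Q.motif, (f₁ + f₂) (((Literature.MathematicalPhysics.StatisticalMechanics.PeriodicConfiguration.finite_inter_points Q (Metric.isBounded_closedBall (x := x) (r := ρ))).toFinset.erase x).image (fun y => y - x))) =
        ((Q.motif.card : ℝ)⁻¹ * ∑ x ∈ Q.motif, f₁ (((Literature.MathematicalPhysics.StatisticalMechanics.PeriodicConfiguration.finite_inter_points Q (Metric.isBounded_closedBall (x := x) (r := ρ))).toFinset.erase x).image (fun y => y - x))) +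
        ((Q.motif.card : ℝ)⁻¹ * ∑ x ∈ Q.motif, f₂ (((Literature.MathematicalPhysics.StatisticalMechanics.PeriodicConfiguration.finite_inter_points Q (Metric.isBounded_closedBall (x := x) (r := ρ))).toFinset.erase x).image (fun y => y - x)))) ∧
      (∀ (ρ t : ℝ) (f : Finset (EuclideanSpace ℝ (Fin 3)) → ℝ),
        ((Q.motif.card : ℝ)⁻¹ * ∑ x ∈ Q.motif, (t • f) (((Literature.MathematicalPhysics.StatisticalMechanics.PeriodicConfiguration.finite_inter_points Q (Metric.isBounded_closedBall (x := x) (r := ρ))).toFinset.erase x).image (fun y => y - x))) =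
        t * ((Q.motif.card : ℝ)⁻¹ * ∑ x ∈ Q.motif, f (((Literature.MathematicalPhysics.StatisticalMechanics.PeriodicConfiguration.finite_inter_points Q (Metric.isBounded_closedBall (x := x) (r := ρ))).toFinset.erase x).image (fun y => y - x)))) ∧
      (∀ (ρ : ℝ) (f : Finset (EuclideanSpace ℝ (Fin 3)) → ℝ), (∀ S : Finset (EuclideanSpace ℝ (Fin 3)), Literature.Probability.PointProcesses.IsRootedPattern δ ρ S → 0 ≤ f S ∧ f S ≤ 1) →
        0 ≤ ((Q.motif.card : ℝ)⁻¹ * ∑ x ∈ Q.motif, f (((Literature.MathematicalPhysics.StatisticalMechanics.PeriodicConfiguration.finite_inter_points Q (Metric.isBounded_closedBall (x := x) (r := ρ))).toFinset.erase x).image (fun y => y - x)))) ∧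
      (∀ ρ : ℝ, ((Q.motif.card : ℝ)⁻¹ * ∑ x ∈ Q.motif, (fun _ => (1 : ℝ)) (((Literature.MathematicalPhysics.StatisticalMechanics.PeriodicConfiguration.finite_inter_points Q (Metric.isBounded_closedBall (x := x) (r := ρ))).toFinset.erase x).image (fun y => y - x))) = 1) ∧
      (∀ ρ ρ' : ℝ, ρ ≤ ρ' → ∀ f : Finset (EuclideanSpace ℝ (Fin 3)) → ℝ,
        ((Q.motif.card : ℝ)⁻¹ * ∑ x ∈ Q.motif, (fun S => f (Literature.Probability.PointProcesses.ballPattern ρ S)) (((Literature.MathematicalPhysics.StatisticalMechanics.PeriodicConfiguration.finite_inter_points Q (Metric.isBounded_closedBall (x := x) (r := ρ'))).toFinset.erase x).image (fun y => y - x))) =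
        ((Q.motif.card : ℝ)⁻¹ * ∑ x ∈ Q.motif, f (((Literature.MathematicalPhysics.StatisticalMechanics.PeriodicConfiguration.finite_inter_points Q (Metric.isBounded_closedBall (x := x) (r := ρ))).toFinset.erase x).image (fun y => y - x)))) := by
  intro δ Q _hδ hsep
  refine ⟨fun ρ f₁ f₂ => ?_, fun ρ t f => ?_, fun ρ f hf => ?_, fun ρ => ?_, fun ρ ρ' hρ f => ?_⟩
  · simp only [Pi.add_apply, Finset.sum_add_distrib, mul_add]
  · simp only [Pi.smul_apply, smul_eq_mul]
    rw [← Finset.mul_sum]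
    ring
  · refine mul_nonneg (inv_nonneg.2 (Nat.cast_nonneg _)) (Finset.sum_nonneg fun x hx => ?_)
    exact (hf _ (periodicMeanFamily_isRootedPattern Q hsep ρ (Q.mem_points_of_mem_motif hx))).1
  · simp only [Finset.sum_const, nsmul_eq_mul, mul_one]
    exact inv_mul_cancel₀ (Nat.cast_ne_zero.2 (Finset.card_pos.2 Q.motif_nonempty).ne')
  · simp only [periodicMeanFamily_ballPattern_pattern Q hρ]

end Summit.AtomisticToContinuum.Crystallization.Theorems.PatternPricedCertificates

end
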